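import Summits.CriticalPhenomena.SAWScalingLimit.Theorems.SAWLeftRightFKGFKGToTraversalBoundSlitNecklaceDefs
import Summits.CriticalPhenomena.SAWScalingLimit.Theorems.SAWLeftRightFKGFKGToTraversalBoundGermExcursionBdry
import HarnessLib

/-!
# Germ tightness is free on the boundary-approximation class (helper `germTight_of_bdryApprox`)

Crux `SAWLeftRightFKG.FKGToTraversalBound` (stmt-CriticalPhenomena-1878), line `slit-necklace`,
registered stub `stub_germTight` (`GermTight D a b a ∧ GermTight D a b b` for EVERY endpoint approximation,
`Theorems/SAWLeftRightFKGFKGToTraversalBoundSlitNecklaceDefs.lean`).  `GermTight D a b e` asks, for every fixed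
outer radius `r > 0` and every `ε > 0`, for a threshold `n` such that eventually in `δ` the critical chord makes
`n` separate traversals of the endpoint-centred shell `D(δ·e_δ; ι(δ), r)`, `ι(δ) = 2·dist(δ·e_δ, ℂ ∖ D) + 4δ`,
with probability `≤ ε`.

This file proves the statement ON THE R1 CLASS (registered helper `germTight_of_bdryApprox`): if both lattice
endpoints are eventually lattice-boundary vertices (`meshBoundary`), the depth of `δ·e_δ` is at most one mesh
(`infDist_compl_le_mesh_of_mem_meshBoundary`, from the tree's
`Percolation.infDist_frontier_le_of_mem_meshBoundary`: a discrete boundary vertex of an open set is within `δ`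
of its frontier, and the frontier of an open set lies in the complement), so the inner radius satisfies
`0 < 4δ ≤ ι(δ) ≤ 6δ < r` once `δ < r / 6`, and the scale-free Aizenman–Burchard short-distance cutoff
`GatesByBubbleDoorsByFKG.not_hasTraversals_of_radius_le_mul_mesh` (no self-avoiding mesh polyline makes
`N = 2((2n+1)²(2n+1)² + 1) + 1` separate traversals of a shell of inner radius `≤ L δ`, `n = ⌈L⌉₊ + 2`; here `L = 6`)
makes the traversal event EMPTY: the bound is deterministic, with the threshold `N` independent of `r`, `ε`, `δ`
(`germTight_of_eventually_mem_meshBoundary`, one marked point at a time).  The hypothesis `IsEndpointApprox` of the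
registered signature is not used (a lattice-boundary vertex is already a site of `Ω_δ`, and positivity of the
inner radius comes from the `4δ`).  Consequently the content of `stub_germTight` lies on the deep fragment.
Only theorems; no named fact; no new definition.
-/

noncomputable section

open MeasureTheory Filter Topology Set Metric
open scoped NNReal ENNReal
open Literature.Probability.LatticeModels
open Literature.Probability.RandomPlanarGeometry
open Literature.Probability.RandomPlanarGeometry.SAW
open Summit.CriticalPhenomena.SAWScalingLimit.Theses.SAWLeftRightFKG
open Summit.CriticalPhenomena.SAWScalingLimit.Theorems.FKGToTraversalBound.GatesByBubbleDoorsByFKG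
  (not_hasTraversals_of_radius_le_mul_mesh)

namespace Summit.CriticalPhenomena.SAWScalingLimit.Theorems.FKGToTraversalBound.SlitNecklace

/-! ### A lattice-boundary vertex has depth at most one mesh -/

/-- **Depth of a lattice-boundary vertex.** For an open set `Ω`, a mesh `δ > 0` and a discrete boundary vertex
`x ∈ ∂Ω_δ`, the mesh point `δx` is within `δ` of the complement `ℂ ∖ Ω`: it is within `|δ| = δ` of the frontier
(`Percolation.infDist_frontier_le_of_mem_meshBoundary`: some lattice edge at `x` leaves `Ω` or `Ω̄`), and the
frontier of an open set is a nonempty subset of its complement. [folklore] -/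
theorem infDist_compl_le_mesh_of_mem_meshBoundary {Ω : Set ℂ} (hΩ : IsOpen Ω) {δ : ℝ} (hδ : 0 < δ)
    {x : Site 2} (hx : x ∈ meshBoundary Ω δ) : infDist (meshPoint δ x) Ωᶜ ≤ δ := by
  have hfr : frontier Ω ⊆ Ωᶜ := by
    rw [← frontier_compl]
    exact hΩ.isClosed_compl.frontier_subset
  calc infDist (meshPoint δ x) Ωᶜ ≤ infDist (meshPoint δ x) (frontier Ω) :=
        infDist_le_infDist_of_subset hfr
          (Literature.Probability.Percolation.frontier_nonempty_of_mem_meshBoundary hΩ hx)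
    _ ≤ |δ| := Literature.Probability.Percolation.infDist_frontier_le_of_mem_meshBoundary hΩ hx
    _ = δ := abs_of_pos hδ

/-! ### Germ tightness at a lattice-boundary marked point is deterministic -/

/-- **Germ tightness at ONE marked point of the boundary class.** If the lattice endpoint `e δ` is eventually a
lattice-boundary vertex of `D_δ`, then `GermTight D a b e` holds with the scale-free cutoff count
`N = 2((2n+1)²(2n+1)² + 1) + 1`, `n = ⌈6⌉₊ + 2`, for every `r` and `ε`: on the germ `0 < δ < r / 6` the inner radius
`ι(δ) = 2·depth + 4δ` satisfies `0 < ι(δ) ≤ 6δ < r` (`infDist_compl_le_mesh_of_mem_meshBoundary`), so by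
`not_hasTraversals_of_radius_le_mul_mesh` no chord makes `N` separate traversals and the event is empty. [folklore] -/
theorem germTight_of_eventually_mem_meshBoundary {D : DobrushinDomain} {a b e : ℝ → Site 2}
    (he : ∀ᶠ δ in 𝓝[>] (0 : ℝ), e δ ∈ meshBoundary D.carrier δ) : GermTight D a b e := by
  intro r hr ε _
  refine ⟨2 * ((2 * (⌈(6 : ℝ)⌉₊ + 2) + 1) ^ 2 * (2 * (⌈(6 : ℝ)⌉₊ + 2) + 1) ^ 2 + 1) + 1, ?_⟩
  have hsmall : Set.Ioo (0 : ℝ) (r / 6) ∈ 𝓝[>] (0 : ℝ) := Ioo_mem_nhdsGT (by positivity)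
  filter_upwards [hsmall, he] with δ hδ heδ
  have hδpos : 0 < δ := hδ.1
  have hδr : δ < r / 6 := hδ.2
  have hd : infDist (meshPoint δ (e δ)) D.carrierᶜ ≤ δ :=
    infDist_compl_le_mesh_of_mem_meshBoundary D.isOpen hδpos heδ
  have hd0 : 0 ≤ infDist (meshPoint δ (e δ)) D.carrierᶜ := infDist_nonneg
  have hρ : 0 < 2 * infDist (meshPoint δ (e δ)) D.carrierᶜ + 4 * δ := by linarith
  have hρL : 2 * infDist (meshPoint δ (e δ)) D.carrierᶜ + 4 * δ ≤ 6 * δ := by linarith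
  have hρr : 2 * infDist (meshPoint δ (e δ)) D.carrierᶜ + 4 * δ < r := by linarith
  have hempty : {γ : DomainSAW D.carrier δ (a δ) (b δ) |
      (polyline γ).HasTraversals
        (2 * ((2 * (⌈(6 : ℝ)⌉₊ + 2) + 1) ^ 2 * (2 * (⌈(6 : ℝ)⌉₊ + 2) + 1) ^ 2 + 1) + 1)
        (meshPoint δ (e δ)) (2 * infDist (meshPoint δ (e δ)) D.carrierᶜ + 4 * δ) r} = ∅ :=
    Set.eq_empty_of_forall_notMem fun γ hγ =>
      not_hasTraversals_of_radius_le_mul_mesh hδpos hρ hρL hρr γ (meshPoint δ (e δ)) hγ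
  rw [hempty, measure_empty]
  exact bot_le

/-! ### The registered helper -/

/-- **`GermTight` on the boundary-approximation class** (registered helper `germTight_of_bdryApprox` of
stmt-CriticalPhenomena-1878, the R1 case of `stub_germTight`).  If along the approximation both lattice endpoints
are eventually lattice-boundary vertices, germ tightness holds at both marked points, deterministically: the
inner radius of the germ shell is between `4δ` and `6δ`, below which the scale-free short-distance cutoff empties
the traversal event (`germTight_of_eventually_mem_meshBoundary`).  The hypothesis `IsEndpointApprox` is not
needed. Hence `stub_germTight` has content only on the deep fragment `depth(δ)/δ → ∞`. [folklore] -/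
theorem germTight_of_bdryApprox : ∀ (D : DobrushinDomain) (a b : ℝ → Site 2), IsEndpointApprox D a b →
    (∀ᶠ δ in 𝓝[>] (0 : ℝ), a δ ∈ meshBoundary D.carrier δ ∧ b δ ∈ meshBoundary D.carrier δ) →
    GermTight D a b a ∧ GermTight D a b b := by
  intro D a b _ hbd
  exact ⟨germTight_of_eventually_mem_meshBoundary (hbd.mono fun δ h => h.1),
    germTight_of_eventually_mem_meshBoundary (hbd.mono fun δ h => h.2)⟩

end Summit.CriticalPhenomena.SAWScalingLimit.Theorems.FKGToTraversalBound.SlitNecklace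

end
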